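import Mathlib.MeasureTheory.Integral.Lebesgue.Add
import Mathlib.MeasureTheory.Measure.Lebesgue.Basic
import Mathlib.Analysis.SpecialFunctions.Pow.Real
import HarnessLib

/-!
# The dyadic iteration of the Dafermos–Rodnianski `r^p` method (abstract real-variable form)
(trunk G08 = T-LORENTZ; statement **gr.S24**; namespace `Literature.Lorentz.DafermosRodnianski`)

Dafermos–Rodnianski's "new physical-space approach to decay" (arXiv:0910.4957 = Proc. XVIth
ICMP (2010) 421–432, the "black box" invoked by Dafermos–Rodnianski–Shlapentokh-Rothman,
arXiv:1402.7034, §3.3, to pass from Thms. 3.1–3.2 to Cor. 3.1) has two logically separate parts: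

1. *PDE input*: uniform boundedness of the energy flux `f(τ) = ∫_{Σ_τ} J^N[φ] n` through a
   foliation whose leaves approach null infinity ((EB-Mink), (EB-Schw)), integrated local energy
   decay (ILED), possibly losing a derivative at trapping ((ILED2-Schw): the right-hand side
   involves `Tφ`), and the hierarchy of `r^p`-weighted energy estimates (p-WE) for `p = 1, 2`,
   whose `p = 1` member bounds `∫_{τ₁}^{τ₂} f(τ) dτ` and the future weighted flux
   `q(τ₂) = ∫_{N_{τ₂}} r (∂_v rφ)²` by `C (q(τ₁) + f(τ₁) + f_T(τ₁))` (eq. (biv) and its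
   Schwarzschild analogue, p. 9 of the arXiv text), and whose `p = 2` member bounds
   `∫_{τ₁}^{τ₂} q(τ) dτ` by data ((afterav));
2. *the iteration*: "This implies that we can find a dyadic sequence `τ_n → ∞` with …",
   "Identifying a good dyadic sequence, applying the boundedness statement (EB-Schw), and using
   the above inequality again with `φ` replaced by `Tφ`, we obtain finally
   `∫_{Σ_τ} J^N[φ] n ≤ C τ⁻² Σ_{i ≤ 2} ∫_{Σ_{τ₁}} r² J^N[T^i φ] n`" (arXiv:0910.4957, §3
   pp. 6–7, §4 p. 9).

This file proves part 2 once and for all, as statements about arbitrary functions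
`f g q : ℝ → ℝ≥0∞` (think `f = ` energy flux of `φ`, `g = ` energy flux of `Tφ`, `q = ` the
`p = 1` weighted flux of `φ`) subject to the inequalities delivered by part 1:

* `decay_of_lintegral_le` (**one step**): quasi-monotonicity `f t ≤ C f s` (`τ₀ ≤ s ≤ t`) and
  `∫_{[s,2s]} f ≤ B` (`s ≥ τ₀`) give `f(2T) ≤ C B T⁻¹` (`T ≥ τ₀`); this is the passage
  (biv) + (EB-Mink) ⇒ `τ⁻¹`, and also the classical "ILED + boundedness ⇒ local energy `≲ 1/τ`".
* `sq_decay_of_hierarchy` (**the two-level hierarchy with loss of one derivative**): if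
  `f, g` are quasi-monotone, `q t ≤ C (q s + f s + g s)`, `∫_{[s,2s]} f ≤ C (q s + f s + g s)`
  (`p = 1` estimate plus ILED-with-loss), `∫_{[s,2s]} q ≤ D` (`p = 2` estimate),
  `∫_{[s,2s]} g ≤ D` (the `p = 1` estimate for `Tφ`, its right-hand side bounded by data) and
  `q τ₀ + f τ₀ + g τ₀ ≤ D`, then `f τ ≤ 152 (max C 1)⁶ D τ⁻²` for `τ ≥ 8τ₀` — the printed
  conclusion (finalest) of §3 / final display of §4, with an explicit, non-optimised constant;
  `sq_decay_of_hierarchy_of_le_one` covers all `τ ≥ τ₀` when `τ₀ ≤ 1`, and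
  `sq_decay_of_hierarchy_noLoss` is the Minkowski version without the `Tφ`-level (`g = 0`).

## Design

* Values in `ℝ≥0∞` and Lebesgue integrals `∫⁻ u in Icc s (2 s), f u` (volume), matching the flux
  vocabulary of `KerrHyperboloidalFlux.lean` (`Kerr.leafFlux … : ℝ≥0∞`); the constant `C : ℝ≥0`.
* **No measurability hypotheses.** The printed argument selects "good" dyadic times by the
  pigeonhole principle, which needs measurability of `τ ↦ q(τ)`. We replace it by integrating the
  quasi-monotonicity inequality `q(2T) ≤ C q(s) + C (f s + g s)` over `s ∈ [T, 2T]`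
  (only a function plus a *constant* is ever split under the integral, `lintegral_add_right'`),
  which gives `q(2T) ≲ D/T` at *every* `T`, and then running the `p = 1` step from `2T`. The
  hypotheses are otherwise exactly the printed inequalities, restricted to dyadic intervals.
* Role in the library: this is node D2 of the decomposition of the named fact
  `Literature.Geometry.Lorentzian.drsr_wave_polynomial_decay_kerr` (`BlackHoles.lean`), below
  `Kerr.drsr_corollary_3_1_scri_flux_decay` (`KerrHyperboloidalFlux.lean`): Cor. 3.1 of
  arXiv:1402.7034 is `sq_decay_of_hierarchy` applied to the boundedness, ILED and `r^p`-weighted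
  estimates for `ψ` and `Tψ` through a hyperboloidal foliation terminating at `𝓘⁺` (the PDE input,
  not formalised).

## References

* M. Dafermos, I. Rodnianski, *A new physical-space approach to decay for the wave equation with
  applications to black hole spacetimes*, XVIth ICMP, World Scientific 2010, 421–432,
  arXiv:0910.4957: §3 (Minkowski: (ILED-Mink), (p-WE-Mink), (afterav), (biv), (EB-Mink),
  (finalest)), §4 (Schwarzschild: (EB-Schw), (ILED1/2-Schw), (p-WE-Schw), final display of p. 9
  of the arXiv text) (key
  `DafermosRodnianski2010ICMP`).
* M. Dafermos, I. Rodnianski, Y. Shlapentokh-Rothman, arXiv:1402.7034 = Ann. of Math. 183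
  (2016), §3.3, Cor. 3.1 (key `DafermosRodnianskiShlapentokhrothman2014`).
* G. Moschidis, *The `r^p`-weighted energy method of Dafermos and Rodnianski in general
  asymptotically flat spacetimes and applications*, Ann. PDE 2 (2016), arXiv:1509.08489 (key
  `Moschidis2016`).
-/

noncomputable section

open MeasureTheory Set
open scoped ENNReal NNReal

namespace Literature.Geometry.Lorentzian

namespace DafermosRodnianski

variable {f g q : ℝ → ℝ≥0∞} {C : ℝ≥0} {B D : ℝ≥0∞} {τ₀ : ℝ}

/-! ### Two elementary inequalities -/

/-- **Quasi-monotone functions bound their integral from below**: if `f b ≤ C f t` for all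
`t ∈ [a, b]`, then `(b − a) f(b) ≤ C ∫_{[a,b]} f` (the constant `f b` is a measurable minorant of
`C f` on `[a, b]`; no measurability of `f` is needed). This replaces the pigeonhole step of
Dafermos–Rodnianski, arXiv:0910.4957, §3 ("(biv) and (EB-Mink) easily imply (finalest)"). [folklore] -/
theorem ofReal_sub_mul_le_mul_lintegral {f : ℝ → ℝ≥0∞} {C : ℝ≥0} {a b : ℝ}
    (hmono : ∀ t ∈ Icc a b, f b ≤ C * f t) :
    ENNReal.ofReal (b - a) * f b ≤ C * ∫⁻ t in Icc a b, f t := by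
  calc ENNReal.ofReal (b - a) * f b = ∫⁻ _ in Icc a b, f b := by
        rw [setLIntegral_const, Real.volume_Icc, mul_comm]
    _ ≤ ∫⁻ t in Icc a b, C * f t := setLIntegral_mono' measurableSet_Icc hmono
    _ = C * ∫⁻ t in Icc a b, f t := lintegral_const_mul' _ _ ENNReal.coe_ne_top

/-- Division by a positive real in `ℝ≥0∞`: `T x ≤ y` with `T > 0` gives `x ≤ y T⁻¹`. [folklore] -/
theorem le_mul_ofReal_inv_of_ofReal_mul_le {x y : ℝ≥0∞} {T : ℝ} (hT : 0 < T)
    (h : ENNReal.ofReal T * x ≤ y) : x ≤ y * ENNReal.ofReal T⁻¹ := by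
  have h1 : ENNReal.ofReal T * ENNReal.ofReal T⁻¹ = 1 := by
    rw [← ENNReal.ofReal_mul hT.le, mul_inv_cancel₀ hT.ne', ENNReal.ofReal_one]
  calc x = ENNReal.ofReal T * x * ENNReal.ofReal T⁻¹ := by
        rw [mul_comm (ENNReal.ofReal T) x, mul_assoc, h1, mul_one]
    _ ≤ y * ENNReal.ofReal T⁻¹ := by gcongr

/-! ### One step: boundedness and an integrated bound give `τ⁻¹` decay -/

/-- **One step of the Dafermos–Rodnianski iteration.** If `f` is quasi-monotone on `[τ₀, ∞)`
(`f t ≤ C f s` for `τ₀ ≤ s ≤ t`: energy boundedness (EB)) and `∫_{[s, 2s]} f ≤ B` for all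
`s ≥ τ₀` (e.g. the `p = 1` weighted estimate (biv) with bounded right-hand side, or ILED for a
local energy), then `f(2T) ≤ C B T⁻¹` for all `T ≥ τ₀` (`τ₀ > 0`). Dafermos–Rodnianski,
arXiv:0910.4957, §3, (biv) + (EB-Mink) ⇒ decay (first pass). [cite: DafermosRodnianski2010ICMP, §3 (biv)–(finalest)] -/
theorem decay_of_lintegral_le (hτ₀ : 0 < τ₀)
    (hf : ∀ s t, τ₀ ≤ s → s ≤ t → f t ≤ C * f s)
    (hint : ∀ s, τ₀ ≤ s → ∫⁻ u in Icc s (2 * s), f u ≤ B) :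
    ∀ T, τ₀ ≤ T → f (2 * T) ≤ C * B * ENNReal.ofReal T⁻¹ := by
  intro T hT
  have hTpos : 0 < T := hτ₀.trans_le hT
  have key : ENNReal.ofReal T * f (2 * T) ≤ C * B := by
    have h := ofReal_sub_mul_le_mul_lintegral (f := f) (C := C) (a := T) (b := 2 * T)
      (fun t ht ↦ hf t (2 * T) (hT.trans ht.1) ht.2)
    rw [show 2 * T - T = T by ring] at h
    calc ENNReal.ofReal T * f (2 * T) ≤ C * ∫⁻ u in Icc T (2 * T), f u := h
      _ ≤ C * B := by gcongr; exact hint T hT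
  exact le_mul_ofReal_inv_of_ofReal_mul_le hTpos key

/-- The same one-step decay written at every `τ ≥ 2τ₀`: `f τ ≤ 2 C B τ⁻¹`.
Dafermos–Rodnianski, arXiv:0910.4957, §3. [cite: DafermosRodnianski2010ICMP, §3 (biv)–(finalest)] -/
theorem decay_of_lintegral_le' (hτ₀ : 0 < τ₀)
    (hf : ∀ s t, τ₀ ≤ s → s ≤ t → f t ≤ C * f s)
    (hint : ∀ s, τ₀ ≤ s → ∫⁻ u in Icc s (2 * s), f u ≤ B) :
    ∀ τ, 2 * τ₀ ≤ τ → f τ ≤ 2 * C * B * ENNReal.ofReal τ⁻¹ := by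
  intro τ hτ
  have hτpos : 0 < τ := by linarith
  have h := decay_of_lintegral_le hτ₀ hf hint (τ / 2) (by linarith)
  rw [show 2 * (τ / 2) = τ by ring] at h
  have h2 : ENNReal.ofReal (τ / 2)⁻¹ = 2 * ENNReal.ofReal τ⁻¹ := by
    rw [inv_div, div_eq_mul_inv, ENNReal.ofReal_mul zero_le_two, ENNReal.ofReal_ofNat]
  calc f τ ≤ C * B * ENNReal.ofReal (τ / 2)⁻¹ := h
    _ = 2 * C * B * ENNReal.ofReal τ⁻¹ := by rw [h2]; ring

/-! ### The two-level hierarchy with loss of one derivative: `τ⁻²` decay -/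

/-- **The dyadic iteration of the Dafermos–Rodnianski `r^p` method, with loss of one
derivative** (abstract form of arXiv:0910.4957, §4: (p-WE-Schw) for `p = 1, 2`, (ILED2-Schw) and
(EB-Schw) give the final display of p. 9,
`∫_{Σ_τ} J^N[φ] n ≤ C τ⁻² Σ_{i≤2} ∫_{Σ_{τ₁}} r² J^N[T^iφ] n`; the same iteration yields the first
estimate of DRSR arXiv:1402.7034, Cor. 3.1). Let `τ₀ > 0` and
`f g q : ℝ → ℝ≥0∞` (the energy fluxes of `φ` and `Tφ` through the leaves `Σ_τ`, and the `p = 1`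
weighted flux `∫_{N_τ} r (∂_v rφ)²` of `φ`) satisfy, for a constant `C` and a data bound `D`:
(EB) `f t ≤ C f s`, `g t ≤ C g s` for `τ₀ ≤ s ≤ t`; (p = 1, future boundary term)
`q t ≤ C (q s + f s + g s)`; (p = 1, bulk term, plus ILED losing one derivative)
`∫_{[s,2s]} f ≤ C (q s + f s + g s)`; (p = 2, bulk term, right-hand side bounded by data)
`∫_{[s,2s]} q ≤ D`; (p = 1 for `Tφ`, right-hand side bounded by data) `∫_{[s,2s]} g ≤ D`; and
`q τ₀ + f τ₀ + g τ₀ ≤ D`. Then `f τ ≤ 152 (max C 1)⁶ D τ⁻²` for all `τ ≥ 8 τ₀`. Proof: a first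
pass (`decay_of_lintegral_le`) gives `f, g ≲ D/τ`; integrating the boundary inequality for `q`
over `s ∈ [T, 2T]` against the `p = 2` bound gives `q(2T) ≲ D/T`; then the `p = 1` bulk bound from
`2T` and quasi-monotonicity of `f` on `[2T, 4T]` give `f(4T) ≲ D/T²`. [cite: DafermosRodnianski2010ICMP, §4 p. 9 (final display); §3 (finalest)] -/
theorem sq_decay_of_hierarchy (hτ₀ : 0 < τ₀)
    (hf : ∀ s t, τ₀ ≤ s → s ≤ t → f t ≤ C * f s)
    (hg : ∀ s t, τ₀ ≤ s → s ≤ t → g t ≤ C * g s)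
    (hq : ∀ s t, τ₀ ≤ s → s ≤ t → q t ≤ C * (q s + f s + g s))
    (hI : ∀ s, τ₀ ≤ s → ∫⁻ u in Icc s (2 * s), f u ≤ C * (q s + f s + g s))
    (hJ : ∀ s, τ₀ ≤ s → ∫⁻ u in Icc s (2 * s), g u ≤ D)
    (hP : ∀ s, τ₀ ≤ s → ∫⁻ u in Icc s (2 * s), q u ≤ D)
    (h0 : q τ₀ + f τ₀ + g τ₀ ≤ D) :
    ∀ τ, 8 * τ₀ ≤ τ →
      f τ ≤ 152 * ((max C 1 : ℝ≥0) : ℝ≥0∞) ^ 6 * D * ENNReal.ofReal (τ ^ (-2 : ℝ)) := by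
  -- normalise the constant: `c = max C 1 ≥ 1`
  set c : ℝ≥0∞ := ((max C 1 : ℝ≥0) : ℝ≥0∞) with hc
  have hCc : (C : ℝ≥0∞) ≤ c := by rw [hc]; exact_mod_cast le_max_left C 1
  have h1c : (1 : ℝ≥0∞) ≤ c := by rw [hc]; exact_mod_cast le_max_right C 1
  have hc_top : c ≠ ⊤ := ENNReal.coe_ne_top
  have hpow : ∀ {m n : ℕ}, m ≤ n → c ^ m ≤ c ^ n := fun h ↦ pow_le_pow_right₀ h1c h
  have hf' : ∀ s t, τ₀ ≤ s → s ≤ t → f t ≤ c * f s :=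
    fun s t hs hst ↦ (hf s t hs hst).trans (by gcongr)
  have hg' : ∀ s t, τ₀ ≤ s → s ≤ t → g t ≤ c * g s :=
    fun s t hs hst ↦ (hg s t hs hst).trans (by gcongr)
  have hq' : ∀ s t, τ₀ ≤ s → s ≤ t → q t ≤ c * (q s + f s + g s) :=
    fun s t hs hst ↦ (hq s t hs hst).trans (by gcongr)
  have hI' : ∀ s, τ₀ ≤ s → ∫⁻ u in Icc s (2 * s), f u ≤ c * (q s + f s + g s) :=
    fun s hs ↦ (hI s hs).trans (by gcongr)
  -- Step A: everything is bounded by `c D` on `[τ₀, ∞)`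
  have hA_f : ∀ s, τ₀ ≤ s → f s ≤ c * D := by
    intro s hs
    calc f s ≤ c * f τ₀ := hf' τ₀ s le_rfl hs
      _ ≤ c * D := by
          gcongr
          exact le_trans (le_trans le_add_self le_self_add) h0
  have hA_g : ∀ s, τ₀ ≤ s → g s ≤ c * D := by
    intro s hs
    calc g s ≤ c * g τ₀ := hg' τ₀ s le_rfl hs
      _ ≤ c * D := by
          gcongr
          exact le_trans le_add_self h0
  have hA_q : ∀ s, τ₀ ≤ s → q s ≤ c * D := by
    intro s hs
    calc q s ≤ c * (q τ₀ + f τ₀ + g τ₀) := hq' τ₀ s le_rfl hs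
      _ ≤ c * D := by gcongr
  -- Step B: the `p = 1` bulk bound has bounded right-hand side
  have hB : ∀ s, τ₀ ≤ s → ∫⁻ u in Icc s (2 * s), f u ≤ 3 * c ^ 2 * D := by
    intro s hs
    calc ∫⁻ u in Icc s (2 * s), f u ≤ c * (q s + f s + g s) := hI' s hs
      _ ≤ c * (c * D + c * D + c * D) := by
          gcongr
          · exact hA_q s hs
          · exact hA_f s hs
          · exact hA_g s hs
      _ = 3 * c ^ 2 * D := by ring
  -- Step C: first pass, `f(2T), g(2T) ≤ 3 c³ D T⁻¹` for `T ≥ τ₀`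
  have hC_f : ∀ T, τ₀ ≤ T → f (2 * T) ≤ 3 * c ^ 3 * D * ENNReal.ofReal T⁻¹ := by
    intro T hT
    have h := decay_of_lintegral_le (C := max C 1) (B := 3 * c ^ 2 * D) hτ₀ hf' hB T hT
    calc f (2 * T) ≤ c * (3 * c ^ 2 * D) * ENNReal.ofReal T⁻¹ := h
      _ = 3 * c ^ 3 * D * ENNReal.ofReal T⁻¹ := by ring
  have hC_g : ∀ T, τ₀ ≤ T → g (2 * T) ≤ 3 * c ^ 3 * D * ENNReal.ofReal T⁻¹ := by
    intro T hT
    have h := decay_of_lintegral_le (C := max C 1) (B := D) hτ₀ hg' hJ T hT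
    have h13 : (1 : ℝ≥0∞) * c ^ 1 ≤ 3 * c ^ 3 :=
      mul_le_mul' (by norm_num) (hpow (by norm_num))
    calc g (2 * T) ≤ c * D * ENNReal.ofReal T⁻¹ := h
      _ = 1 * c ^ 1 * D * ENNReal.ofReal T⁻¹ := by ring
      _ ≤ 3 * c ^ 3 * D * ENNReal.ofReal T⁻¹ :=
          mul_le_mul' (mul_le_mul' h13 le_rfl) le_rfl
  -- Step C': on `[T, 2T]` with `T ≥ 2τ₀`, `f s + g s ≤ 12 c³ D T⁻¹`
  have hC' : ∀ T s, 2 * τ₀ ≤ T → T ≤ s →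
      f s + g s ≤ 12 * c ^ 3 * D * ENNReal.ofReal T⁻¹ := by
    intro T s hT hs
    have hTpos : 0 < T := by linarith
    have hs2 : τ₀ ≤ s / 2 := by linarith
    have hf2 := hC_f (s / 2) hs2
    have hg2 := hC_g (s / 2) hs2
    rw [show 2 * (s / 2) = s by ring] at hf2 hg2
    have hinv : ENNReal.ofReal (s / 2)⁻¹ ≤ 2 * ENNReal.ofReal T⁻¹ := by
      rw [inv_div, div_eq_mul_inv, ENNReal.ofReal_mul zero_le_two, ENNReal.ofReal_ofNat]
      exact mul_le_mul' le_rfl (ENNReal.ofReal_le_ofReal (inv_anti₀ hTpos hs))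
    calc f s + g s
        ≤ 3 * c ^ 3 * D * ENNReal.ofReal (s / 2)⁻¹ + 3 * c ^ 3 * D * ENNReal.ofReal (s / 2)⁻¹ :=
          add_le_add hf2 hg2
      _ ≤ 3 * c ^ 3 * D * (2 * ENNReal.ofReal T⁻¹) + 3 * c ^ 3 * D * (2 * ENNReal.ofReal T⁻¹) :=
          add_le_add (mul_le_mul' le_rfl hinv) (mul_le_mul' le_rfl hinv)
      _ = 12 * c ^ 3 * D * ENNReal.ofReal T⁻¹ := by ring
  -- Step D: `q(2T) ≤ 13 c⁴ D T⁻¹` for `T ≥ 2τ₀`, integrating the boundary inequality over `[T, 2T]`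
  have hD : ∀ T, 2 * τ₀ ≤ T → q (2 * T) ≤ 13 * c ^ 4 * D * ENNReal.ofReal T⁻¹ := by
    intro T hT
    have hTpos : 0 < T := by linarith
    have hT₀ : τ₀ ≤ T := by linarith
    set E : ℝ≥0∞ := c * (12 * c ^ 3 * D * ENNReal.ofReal T⁻¹) with hE
    have hpt : ∀ s ∈ Icc T (2 * T), q (2 * T) ≤ c * q s + E := by
      intro s hs
      calc q (2 * T) ≤ c * (q s + f s + g s) := hq' s (2 * T) (hT₀.trans hs.1) hs.2
        _ = c * q s + c * (f s + g s) := by ring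
        _ ≤ c * q s + E := add_le_add le_rfl (mul_le_mul' le_rfl (hC' T s hT hs.1))
    have hint : ENNReal.ofReal T * q (2 * T) ≤ c * D + E * ENNReal.ofReal T := by
      calc ENNReal.ofReal T * q (2 * T) = ∫⁻ _ in Icc T (2 * T), q (2 * T) := by
            rw [setLIntegral_const, Real.volume_Icc, show 2 * T - T = T by ring, mul_comm]
        _ ≤ ∫⁻ s in Icc T (2 * T), (c * q s + E) := setLIntegral_mono' measurableSet_Icc hpt
        _ = c * (∫⁻ s in Icc T (2 * T), q s) + E * ENNReal.ofReal T := by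
            rw [lintegral_add_right' _ aemeasurable_const, lintegral_const_mul' _ _ hc_top,
              setLIntegral_const, Real.volume_Icc, show 2 * T - T = T by ring]
        _ ≤ c * D + E * ENNReal.ofReal T :=
            add_le_add (mul_le_mul' le_rfl (hP T hT₀)) le_rfl
    have h := le_mul_ofReal_inv_of_ofReal_mul_le hTpos hint
    have h1 : ENNReal.ofReal T * ENNReal.ofReal T⁻¹ = 1 := by
      rw [← ENNReal.ofReal_mul hTpos.le, mul_inv_cancel₀ hTpos.ne', ENNReal.ofReal_one]
    calc q (2 * T) ≤ (c * D + E * ENNReal.ofReal T) * ENNReal.ofReal T⁻¹ := h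
      _ = c * D * ENNReal.ofReal T⁻¹ + E * (ENNReal.ofReal T * ENNReal.ofReal T⁻¹) := by ring
      _ = c * D * ENNReal.ofReal T⁻¹ + E := by rw [h1, mul_one]
      _ = (c ^ 1 + 12 * c ^ 4) * D * ENNReal.ofReal T⁻¹ := by rw [hE]; ring
      _ ≤ (c ^ 4 + 12 * c ^ 4) * D * ENNReal.ofReal T⁻¹ :=
          mul_le_mul' (mul_le_mul' (add_le_add (hpow (by norm_num)) le_rfl) le_rfl) le_rfl
      _ = 13 * c ^ 4 * D * ENNReal.ofReal T⁻¹ := by ring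
  -- Step E: the `p = 1` bulk bound from `2T` and quasi-monotonicity of `f` on `[2T, 4T]`
  have hE : ∀ T, 2 * τ₀ ≤ T →
      f (4 * T) ≤ 19 * c ^ 6 * D * (ENNReal.ofReal T⁻¹ * ENNReal.ofReal (2 * T)⁻¹) := by
    intro T hT
    have hTpos : 0 < T := by linarith
    have hT₀ : τ₀ ≤ 2 * T := by linarith
    have hint : ∫⁻ u in Icc (2 * T) (2 * (2 * T)), f u ≤ 19 * c ^ 5 * D * ENNReal.ofReal T⁻¹ := by
      calc ∫⁻ u in Icc (2 * T) (2 * (2 * T)), f u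
          ≤ c * (q (2 * T) + f (2 * T) + g (2 * T)) := hI' (2 * T) hT₀
        _ ≤ c * (13 * c ^ 4 * D * ENNReal.ofReal T⁻¹ + 3 * c ^ 3 * D * ENNReal.ofReal T⁻¹ +
              3 * c ^ 3 * D * ENNReal.ofReal T⁻¹) := by
            gcongr
            · exact hD T hT
            · exact hC_f T (by linarith)
            · exact hC_g T (by linarith)
        _ = (13 * c ^ 5 + 6 * c ^ 4) * D * ENNReal.ofReal T⁻¹ := by ring
        _ ≤ (13 * c ^ 5 + 6 * c ^ 5) * D * ENNReal.ofReal T⁻¹ :=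
            mul_le_mul' (mul_le_mul' (add_le_add le_rfl (mul_le_mul' le_rfl (hpow (by norm_num))))
              le_rfl) le_rfl
        _ = 19 * c ^ 5 * D * ENNReal.ofReal T⁻¹ := by ring
    have hmono : ∀ t ∈ Icc (2 * T) (2 * (2 * T)), f (2 * (2 * T)) ≤ c * f t :=
      fun t ht ↦ hf' t _ (hT₀.trans ht.1) ht.2
    have h := ofReal_sub_mul_le_mul_lintegral hmono
    rw [show 2 * (2 * T) - 2 * T = 2 * T by ring] at h
    have h' : ENNReal.ofReal (2 * T) * f (2 * (2 * T)) ≤ 19 * c ^ 6 * D * ENNReal.ofReal T⁻¹ :=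
      calc ENNReal.ofReal (2 * T) * f (2 * (2 * T))
          ≤ c * ∫⁻ u in Icc (2 * T) (2 * (2 * T)), f u := h
        _ ≤ c * (19 * c ^ 5 * D * ENNReal.ofReal T⁻¹) := by gcongr
        _ = 19 * c ^ 6 * D * ENNReal.ofReal T⁻¹ := by ring
    have h'' := le_mul_ofReal_inv_of_ofReal_mul_le (by linarith : 0 < 2 * T) h'
    rw [show 2 * (2 * T) = 4 * T by ring] at h''
    calc f (4 * T) ≤ 19 * c ^ 6 * D * ENNReal.ofReal T⁻¹ * ENNReal.ofReal (2 * T)⁻¹ := h''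
      _ = 19 * c ^ 6 * D * (ENNReal.ofReal T⁻¹ * ENNReal.ofReal (2 * T)⁻¹) := by ring
  -- Step F: rescale `τ = 4T`
  intro τ hτ
  have hτpos : 0 < τ := by linarith
  have hT : 2 * τ₀ ≤ τ / 4 := by linarith
  have h := hE (τ / 4) hT
  rw [show 4 * (τ / 4) = τ by ring] at h
  have hprod : ENNReal.ofReal (τ / 4)⁻¹ * ENNReal.ofReal (2 * (τ / 4))⁻¹ =
      8 * ENNReal.ofReal (τ ^ (-2 : ℝ)) := by
    rw [← ENNReal.ofReal_mul (by positivity), Real.rpow_neg hτpos.le, Real.rpow_two,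
      show (τ / 4)⁻¹ * (2 * (τ / 4))⁻¹ = 8 * (τ ^ 2)⁻¹ by field_simp; ring,
      ENNReal.ofReal_mul (by norm_num), ENNReal.ofReal_ofNat]
  calc f τ ≤ 19 * c ^ 6 * D * (ENNReal.ofReal (τ / 4)⁻¹ * ENNReal.ofReal (2 * (τ / 4))⁻¹) := h
    _ = 19 * c ^ 6 * D * (8 * ENNReal.ofReal (τ ^ (-2 : ℝ))) := by rw [hprod]
    _ = 152 * c ^ 6 * D * ENNReal.ofReal (τ ^ (-2 : ℝ)) := by ring

/-- The hierarchy estimate at all times `τ ≥ τ₀` when `0 < τ₀ ≤ 1` (on `[τ₀, 8τ₀]` boundedness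
alone gives `f τ ≤ C D ≤ 64 C D τ⁻²`). Dafermos–Rodnianski, arXiv:0910.4957, §3 (finalest) "for
any `τ ≥ τ₁`", §4 p. 9. [cite: DafermosRodnianski2010ICMP, §4 p. 9 (final display); §3 (finalest)] -/
theorem sq_decay_of_hierarchy_of_le_one (hτ₀ : 0 < τ₀) (hτ₁ : τ₀ ≤ 1)
    (hf : ∀ s t, τ₀ ≤ s → s ≤ t → f t ≤ C * f s)
    (hg : ∀ s t, τ₀ ≤ s → s ≤ t → g t ≤ C * g s)
    (hq : ∀ s t, τ₀ ≤ s → s ≤ t → q t ≤ C * (q s + f s + g s))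
    (hI : ∀ s, τ₀ ≤ s → ∫⁻ u in Icc s (2 * s), f u ≤ C * (q s + f s + g s))
    (hJ : ∀ s, τ₀ ≤ s → ∫⁻ u in Icc s (2 * s), g u ≤ D)
    (hP : ∀ s, τ₀ ≤ s → ∫⁻ u in Icc s (2 * s), q u ≤ D)
    (h0 : q τ₀ + f τ₀ + g τ₀ ≤ D) :
    ∀ τ, τ₀ ≤ τ →
      f τ ≤ 152 * ((max C 1 : ℝ≥0) : ℝ≥0∞) ^ 6 * D * ENNReal.ofReal (τ ^ (-2 : ℝ)) := by
  intro τ hτ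
  by_cases h8 : 8 * τ₀ ≤ τ
  · exact sq_decay_of_hierarchy hτ₀ hf hg hq hI hJ hP h0 τ h8
  · have h8' : τ < 8 * τ₀ := not_le.mp h8
    have hτpos : 0 < τ := hτ₀.trans_le hτ
    have hτ8 : τ < 8 := by linarith
    set c : ℝ≥0∞ := ((max C 1 : ℝ≥0) : ℝ≥0∞) with hc
    have hCc : (C : ℝ≥0∞) ≤ c := by rw [hc]; exact_mod_cast le_max_left C 1
    have h1c : (1 : ℝ≥0∞) ≤ c := by rw [hc]; exact_mod_cast le_max_right C 1
    have hfτ : f τ ≤ c * D :=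
      calc f τ ≤ C * f τ₀ := hf τ₀ τ le_rfl hτ
        _ ≤ c * D := by
            gcongr
            exact le_trans (le_trans le_add_self le_self_add) h0
    have hlow : (1 : ℝ≥0∞) ≤ 64 * ENNReal.ofReal (τ ^ (-2 : ℝ)) := by
      rw [Real.rpow_neg hτpos.le, Real.rpow_two, ← ENNReal.ofReal_ofNat,
        ← ENNReal.ofReal_mul (by norm_num), ← ENNReal.ofReal_one]
      apply ENNReal.ofReal_le_ofReal
      rw [← div_eq_mul_inv, le_div_iff₀ (by positivity)]
      nlinarith
    calc f τ ≤ c * D := hfτ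
      _ = c ^ 1 * D * 1 := by ring
      _ ≤ c ^ 6 * D * (64 * ENNReal.ofReal (τ ^ (-2 : ℝ))) :=
          mul_le_mul' (mul_le_mul' (pow_le_pow_right₀ h1c (by norm_num)) le_rfl) hlow
      _ = 64 * c ^ 6 * D * ENNReal.ofReal (τ ^ (-2 : ℝ)) := by ring
      _ ≤ 152 * c ^ 6 * D * ENNReal.ofReal (τ ^ (-2 : ℝ)) :=
          mul_le_mul' (mul_le_mul' (mul_le_mul' (by norm_num) le_rfl) le_rfl) le_rfl

/-- **The Minkowski case (no loss of derivative)**: Dafermos–Rodnianski, arXiv:0910.4957, §3: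
(EB-Mink) `f t ≤ C f s`; (p-WE-Mink) with `p = 1` plus (ILED-Mink), giving (biv) without the
`Tφ` term: `∫_{[s,2s]} f ≤ C (q s + f s)` and `q t ≤ C (q s + f s)`; (afterav) (`p = 2`):
`∫_{[s,2s]} q ≤ D`; data `q τ₀ + f τ₀ ≤ D`. Conclusion (finalest): `f τ ≤ 152 (max C 1)⁶ D τ⁻²`
for `τ ≥ 8τ₀` (the printed `C τ⁻² [∫ r² (∂_v ψ)² + ∫_{Σ_{τ₁}} J^T n]`, the bracket being `D`).
Special case `g = 0` of `sq_decay_of_hierarchy`. [cite: DafermosRodnianski2010ICMP, §3 (finalest)] -/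
theorem sq_decay_of_hierarchy_noLoss (hτ₀ : 0 < τ₀)
    (hf : ∀ s t, τ₀ ≤ s → s ≤ t → f t ≤ C * f s)
    (hq : ∀ s t, τ₀ ≤ s → s ≤ t → q t ≤ C * (q s + f s))
    (hI : ∀ s, τ₀ ≤ s → ∫⁻ u in Icc s (2 * s), f u ≤ C * (q s + f s))
    (hP : ∀ s, τ₀ ≤ s → ∫⁻ u in Icc s (2 * s), q u ≤ D)
    (h0 : q τ₀ + f τ₀ ≤ D) :
    ∀ τ, 8 * τ₀ ≤ τ →
      f τ ≤ 152 * ((max C 1 : ℝ≥0) : ℝ≥0∞) ^ 6 * D * ENNReal.ofReal (τ ^ (-2 : ℝ)) := by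
  refine sq_decay_of_hierarchy (g := fun _ ↦ 0) hτ₀ hf (fun s t _ _ ↦ by simp)
    (fun s t hs hst ↦ by simpa using hq s t hs hst) (fun s hs ↦ by simpa using hI s hs)
    (fun s _ ↦ by simp) hP (by simpa using h0)

end DafermosRodnianski

end Literature.Geometry.Lorentzian

end
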